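import Summits.BirchSwinnertonDyer.BirchSwinnertonDyer.Theorems.PrintCf2SplitBadTwoLocalPointsScalarAlgebra
import Literature.NumberTheory.EllipticCurves.LocalPointsFiniteIndexLatticeHolds
import Summits.BirchSwinnertonDyer.BirchSwinnertonDyer.Theorems.PrintCf2SplitBadTwoCMPrimaryLocalPinning
import HarnessLib

/-!
# Crux `PrintCf2.SplitBadTwoRankOneOfFacts` (stmt-BirchSwinnertonDyer-20368), road α v10.3, S3c bottom value — LOCAL POINTS, file 2:
# AT A DYADIC PLACE OF THE FRAME, `E(K_w)/tors` IS A `ℤ₂`-LINE: the scalar of an endomorphism, the DICHOTOMY `c ∈ {r, 1 − r}` for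
# `π² = π − 2`, uniqueness, the rank-one relation, no divisible points (Silverman VII.6.3 at `[K_w : ℚ₂] = 1`)

Cell `bsd-print-cf2`, width seat `bsd-line-cf2-p1-w7` g3; `--supports stmt-BirchSwinnertonDyer-20368` (helper, Theses-free). HONEST FRAMING:
nothing here closes a crux or a stub; BSD is not proved by any of this; no summit statement is proved by this seat. No definition, no
named fact, no `sorry`, no kit. beyond-print theorem: no.

WHAT. §2 `exists_finiteIndex_addEquiv_padicInt_of_finrank_eq_one` / `exists_scalar_localField`: the tree's Silverman VII.6.3
(`LocalFieldPoints.exists_finiteIndex_addEquiv_padicInt_pi`, bsd-inputs desk) at `[F : ℚ_p] = 1` feeds file 1 (`…LocalPointsScalarAlgebra`).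
§3, the S3c frame (`K` quadratic, `v ≠ v̄` above `2`; `e(v|2) f(v|2) = 1` by the fundamental identity, `ramificationIdx_mul_inertiaDeg_eq_one_of_ne`;
`K_v` with the tree's canonical `ℚ₂`-structure `LocalField.adicCompletionPadicAlgebra`, `finrank = e f = 1`), for ANY elliptic `V/K_v` and ANY
additive `f : V(K_v) → V(K_v)`:
* `exists_scalar_adicCompletion_two` — the scalar `c ∈ ℤ₂`; **`scalar_dichotomy_two`** — if `f(f x) = f x − 2x` then `c ∈ {r, 1 − r}` for any
  root `r` (`CMPrimes.eq_or_eq_one_sub_of_root_two`); `scalar_unique_adicCompletion_two` — the two alternatives exclude each other;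
* **`exists_rankOne_rel_adicCompletion_two`** — `2^a y ≡ M x₀ (mod 2^K V(K_v) + tors)` for `x₀` of infinite order (input of (H2));
  `isOfFinAddOrder_of_forall_exists_adicCompletion_two`.
WHAT THIS DOES NOT DO: decide WHICH of `r`, `1 − r` is the scalar of the CM endomorphism at `v` (= which eigen-summand `E[𝔮^∞]` is the
formal group at `v`; Rubin LNM 1716 Lemma 3.6 (ii) / the normalised `[·]`): that bit is the content of (H1′) and is attacked separately.

References: [SilvermanAEC2009] Prop. VII.6.3, Thm. IV.6.4 (b); [NeukirchANT1999] Ch. I §8 (8.2), Ch. II (8.5); [Rubin1999] §3 Lemma 3.6;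
[Agboola2007] §6 Prop. 6.11.
-/

noncomputable section

open scoped Classical

set_option linter.dupNamespace false -- `Summit.BirchSwinnertonDyer.BirchSwinnertonDyer` (summit = problem) is the tree's layout
set_option autoImplicit false

namespace Summit.BirchSwinnertonDyer.BirchSwinnertonDyer.Theorems.PrintCf2.LocalPointsScalar

/-! ## §2. Local fields of degree one over `ℚ_p`: `E(F) ⊇ ℤ_p` of finite index (Silverman VII.6.3) -/

section LocalField

open Literature.NumberTheory.EllipticCurves

/-- **Silverman VII.6.3 in degree one**: for a non-archimedean local field `F` with `[F : ℚ_p] = 1` and an elliptic curve `V/F`,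
`V(F)` has a finite-index subgroup `≃+ ℤ_p` (the tree's `LocalFieldPoints.exists_finiteIndex_addEquiv_padicInt_pi`, `ℤ_p^1 ≃+ ℤ_p`).
[cite: SilvermanAEC2009, Prop. VII.6.3 and Thm. IV.6.4 (b)] -/
theorem exists_finiteIndex_addEquiv_padicInt_of_finrank_eq_one {F : Type*} [Field F] [DecidableEq F] [ValuativeRel F]
    [TopologicalSpace F] [IsNonarchimedeanLocalField F] (p : ℕ) [Fact p.Prime] [Algebra ℚ_[p] F] [FiniteDimensional ℚ_[p] F]
    (h1 : Module.finrank ℚ_[p] F = 1) (V : WeierstrassCurve F) [V.IsElliptic] :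
    ∃ U : AddSubgroup V.toAffine.Point, U.FiniteIndex ∧ Nonempty (U ≃+ ℤ_[p]) := by
  obtain ⟨U, hU, ⟨eU⟩⟩ := LocalFieldPoints.exists_finiteIndex_addEquiv_padicInt_pi_of_decidableEq p V
  rw [h1] at eU
  exact ⟨U, hU, ⟨eU.trans (AddEquiv.piUnique fun _ : Fin 1 ↦ ℤ_[p])⟩⟩

/-- **The scalar of an endomorphism of `V(F)`, `[F : ℚ_p] = 1`**: every additive `f : V(F) → V(F)` acts on `V(F)/V(F)_tors` as
multiplication by a unique `p`-adic integer `c` (in the sense of `exists_scalar`), and `c` satisfies every quadratic relation `f` does.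
[cite: SilvermanAEC2009, Prop. VII.6.3] -/
theorem exists_scalar_localField {F : Type*} [Field F] [DecidableEq F] [ValuativeRel F] [TopologicalSpace F]
    [IsNonarchimedeanLocalField F] (p : ℕ) [Fact p.Prime] [Algebra ℚ_[p] F] [FiniteDimensional ℚ_[p] F]
    (h1 : Module.finrank ℚ_[p] F = 1) (V : WeierstrassCurve F) [V.IsElliptic] (f : V.toAffine.Point →+ V.toAffine.Point) :
    ∃ c : ℤ_[p],
      (∀ (k : ℕ) (N : ℤ), ((N : ℤ_[p]) - c) ∈ Ideal.span {(p : ℤ_[p]) ^ k} →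
        ∀ x : V.toAffine.Point, ∃ y : V.toAffine.Point, IsOfFinAddOrder (f x - N • x - ((p : ℤ) ^ k) • y)) ∧
      (∀ (m₁ c₁ : ℤ), (∀ x, f (f x) + m₁ • f x = c₁ • x) → c * c + m₁ * c = c₁) := by
  obtain ⟨U, hU, ⟨eU⟩⟩ := exists_finiteIndex_addEquiv_padicInt_of_finrank_eq_one p h1 V
  haveI := hU
  exact exists_scalar U eU f

end LocalField

/-! ## §3. The frame: `K` imaginary quadratic, `2 = v·v̄` split, `K_w ≅ ℚ₂`; the DICHOTOMY `c ∈ {r, 1 − r}` -/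

section Frame

open NumberField IsDedekindDomain Field Literature.NumberTheory.EllipticCurves
open Summit.BirchSwinnertonDyer.BirchSwinnertonDyer.Theorems.SchneiderFreeAdditiveX3 (liesOver_span_of_natCast_mem)
open Literature.NumberTheory.GaloisRepresentations (LocalField.adicCompletionPadicAlgebra)
open Summit.BirchSwinnertonDyer.BirchSwinnertonDyer.Theorems.PrintCf2.CMPrimes (eq_or_eq_one_sub_of_root_two)

/-- At a place `v ∣ 2` of a quadratic field with two distinct places above `2`, `e(v|2) f(v|2) = 1` (fundamental identity
`#{w ∣ 2}·e·f = [K:ℚ] = 2` for the Galois extension `K/ℚ`, with `#{w ∣ 2} ≥ 2`). [cite: NeukirchANT1999, Ch. I §8 Prop. (8.2)] -/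
theorem ramificationIdx_mul_inertiaDeg_eq_one_of_ne {K : Type} [Field K] [NumberField K] (hK2 : Module.finrank ℚ K = 2)
    {v vbar : HeightOneSpectrum (𝓞 K)} (hv : ((2 : ℕ) : 𝓞 K) ∈ v.asIdeal) (hvbar : ((2 : ℕ) : 𝓞 K) ∈ vbar.asIdeal)
    (hne : vbar ≠ v) : v.asIdeal.ramificationIdx ℤ * v.asIdeal.inertiaDeg ℤ = 1 := by
  haveI : Fact (Nat.Prime 2) := ⟨Nat.prime_two⟩
  haveI : Algebra.IsQuadraticExtension ℚ K := ⟨hK2⟩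
  haveI hvL := liesOver_span_of_natCast_mem (K := K) hv
  haveI hvbarL := liesOver_span_of_natCast_mem (K := K) hvbar
  haveI : (Ideal.span {((2 : ℕ) : ℤ)}).IsPrime :=
    (Ideal.span_singleton_prime (by norm_num)).mpr (Int.prime_iff_natAbs_prime.mpr (by simpa using Nat.prime_two))
  set G := K ≃ₐ[ℚ] K
  have hG : Nat.card G = 2 := by rw [IsGalois.card_aut_eq_finrank, hK2]
  have hid := Ideal.ncard_primesOver_mul_ramificationIdxIn_mul_inertiaDegIn (Ideal.span {((2 : ℕ) : ℤ)}) (𝓞 K) G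
  rw [hG] at hid
  -- two distinct primes above `2`
  have h2le : 2 ≤ ((Ideal.span {((2 : ℕ) : ℤ)}).primesOver (𝓞 K)).ncard := by
    have hsub : ({v.asIdeal, vbar.asIdeal} : Set (Ideal (𝓞 K))) ⊆ (Ideal.span {((2 : ℕ) : ℤ)}).primesOver (𝓞 K) := by
      intro I hI
      rcases hI with rfl | rfl
      · exact ⟨v.isPrime, hvL⟩
      · exact ⟨vbar.isPrime, hvbarL⟩
    have hne' : v.asIdeal ≠ vbar.asIdeal := fun h ↦ hne (HeightOneSpectrum.ext h).symm
    calc 2 = ({v.asIdeal, vbar.asIdeal} : Set (Ideal (𝓞 K))).ncard := (Set.ncard_pair hne').symm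
      _ ≤ _ := Set.ncard_le_ncard hsub (IsDedekindDomain.primesOver_finite _ _)
  rw [← Ideal.ramificationIdxIn_eq_ramificationIdx (Ideal.span {((2 : ℕ) : ℤ)}) v.asIdeal G,
    ← Ideal.inertiaDegIn_eq_inertiaDeg (Ideal.span {((2 : ℕ) : ℤ)}) v.asIdeal G]
  set n := ((Ideal.span {((2 : ℕ) : ℤ)}).primesOver (𝓞 K)).ncard
  set x := (Ideal.span {((2 : ℕ) : ℤ)}).ramificationIdxIn (𝓞 K) * (Ideal.span {((2 : ℕ) : ℤ)}).inertiaDegIn (𝓞 K)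
  have hx2 : x ≤ 2 := by
    rcases Nat.eq_zero_or_pos x with h | h
    · omega
    · nlinarith
  interval_cases x <;> omega

/-- **THE SCALAR AT A DYADIC PLACE OF THE FRAME.** `K` quadratic with two places `v ≠ v̄` above `2` (so `K_v ≅ ℚ₂`), `V` an
elliptic curve over `K_v` (e.g. `(W.baseChange K).baseChange K_v`), `f` an additive endomorphism of `V(K_v)` (e.g. the local points
map of a `K`-rational endomorphism): there is `c ∈ ℤ₂` with `f ≡ c` modulo `2^k V(K_v) + torsion` for all `k`, and `c` satisfies the
quadratic relations of `f`. [cite: SilvermanAEC2009, Prop. VII.6.3] [cite: NeukirchANT1999, Ch. II Prop. (8.5)] -/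
theorem exists_scalar_adicCompletion_two {K : Type} [Field K] [NumberField K] (hK2 : Module.finrank ℚ K = 2)
    {v vbar : HeightOneSpectrum (𝓞 K)} (hv : ((2 : ℕ) : 𝓞 K) ∈ v.asIdeal) (hvbar : ((2 : ℕ) : 𝓞 K) ∈ vbar.asIdeal)
    (hne : vbar ≠ v) (V : WeierstrassCurve (v.adicCompletion K)) [V.IsElliptic]
    (f : V.toAffine.Point →+ V.toAffine.Point) :
    ∃ c : ℤ_[2],
      (∀ (k : ℕ) (N : ℤ), ((N : ℤ_[2]) - c) ∈ Ideal.span {(2 : ℤ_[2]) ^ k} →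
        ∀ x : V.toAffine.Point, ∃ y : V.toAffine.Point, IsOfFinAddOrder (f x - N • x - ((2 : ℤ) ^ k) • y)) ∧
      (∀ (m₁ c₁ : ℤ), (∀ x, f (f x) + m₁ • f x = c₁ • x) → c * c + m₁ * c = c₁) := by
  letI : Algebra ℚ_[2] (v.adicCompletion K) := LocalField.adicCompletionPadicAlgebra v 2 hv
  have h1 : Module.finrank ℚ_[2] (v.adicCompletion K) = 1 := by
    rw [Literature.NumberTheory.NumberFields.finrank_adicCompletionPadicAlgebra_eq 2 v hv]
    exact ramificationIdx_mul_inertiaDeg_eq_one_of_ne hK2 hv hvbar hne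
  haveI : FiniteDimensional ℚ_[2] (v.adicCompletion K) := Module.finite_of_finrank_pos (by rw [h1]; exact one_pos)
  have h := exists_scalar_localField 2 h1 V f
  exact_mod_cast h

/-- **THE DICHOTOMY for a CM endomorphism `π² = π − 2` at a dyadic place of the frame**: if `f` satisfies `f(f x) = f x − 2x` on
`V(K_v)` and `r ∈ ℤ₂` is a root of `X² − X + 2`, then `f` acts on `V(K_v)/V(K_v)_tors ≅ ℤ₂` as EITHER `r` OR `1 − r`:
there is `c ∈ {r, 1 − r}` with `f x − N x ∈ 2^k V(K_v) + torsion` whenever `N ≡ c (mod 2^k)`. Which of the two holds is NOT decided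
here (it is the normalisation of `[·] : 𝓞_K → End E` at `v`, i.e. which eigen-summand is the formal group at `v`).
[cite: SilvermanAEC2009, Prop. VII.6.3] [cite: Rubin1999, §3 Lemma 3.6 (ii)] -/
theorem scalar_dichotomy_two {K : Type} [Field K] [NumberField K] (hK2 : Module.finrank ℚ K = 2)
    {v vbar : HeightOneSpectrum (𝓞 K)} (hv : ((2 : ℕ) : 𝓞 K) ∈ v.asIdeal) (hvbar : ((2 : ℕ) : 𝓞 K) ∈ vbar.asIdeal)
    (hne : vbar ≠ v) (V : WeierstrassCurve (v.adicCompletion K)) [V.IsElliptic]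
    (f : V.toAffine.Point →+ V.toAffine.Point) (hf : ∀ x, f (f x) = f x - (2 : ℤ) • x) {r : ℤ_[2]} (hr : r * r = r - 2) :
    ∃ c : ℤ_[2], (c = r ∨ c = 1 - r) ∧
      ∀ (k : ℕ) (N : ℤ), ((N : ℤ_[2]) - c) ∈ Ideal.span {(2 : ℤ_[2]) ^ k} →
        ∀ x : V.toAffine.Point, ∃ y : V.toAffine.Point, IsOfFinAddOrder (f x - N • x - ((2 : ℤ) ^ k) • y) := by
  obtain ⟨c, hA, hB⟩ := exists_scalar_adicCompletion_two hK2 hv hvbar hne V f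
  have hrel : c * c + (-1 : ℤ) * c = (-2 : ℤ) := hB (-1) (-2) (fun x ↦ by rw [hf, neg_smul, one_smul, neg_smul]; abel)
  have hc : c * c = c - 2 := by
    have : c * c + (-1 : ℤ_[2]) * c = -2 := by exact_mod_cast hrel
    linear_combination this
  exact ⟨c, eq_or_eq_one_sub_of_root_two hc hr, hA⟩

/-- **UNIQUENESS at a dyadic place of the frame**: the scalar is unique, so the two alternatives of `scalar_dichotomy_two` are
mutually exclusive (`r ≠ 1 − r`, `CMPrimes.root_ne_one_sub_two`). [cite: SilvermanAEC2009, Prop. VII.6.3] -/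
theorem scalar_unique_adicCompletion_two {K : Type} [Field K] [NumberField K] (hK2 : Module.finrank ℚ K = 2)
    {v vbar : HeightOneSpectrum (𝓞 K)} (hv : ((2 : ℕ) : 𝓞 K) ∈ v.asIdeal) (hvbar : ((2 : ℕ) : 𝓞 K) ∈ vbar.asIdeal)
    (hne : vbar ≠ v) (V : WeierstrassCurve (v.adicCompletion K)) [V.IsElliptic]
    (f : V.toAffine.Point →+ V.toAffine.Point) {c c' : ℤ_[2]}
    (hc : ∀ (k : ℕ) (N : ℤ), ((N : ℤ_[2]) - c) ∈ Ideal.span {(2 : ℤ_[2]) ^ k} →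
      ∀ x : V.toAffine.Point, ∃ y : V.toAffine.Point, IsOfFinAddOrder (f x - N • x - ((2 : ℤ) ^ k) • y))
    (hc' : ∀ (k : ℕ) (N : ℤ), ((N : ℤ_[2]) - c') ∈ Ideal.span {(2 : ℤ_[2]) ^ k} →
      ∀ x : V.toAffine.Point, ∃ y : V.toAffine.Point, IsOfFinAddOrder (f x - N • x - ((2 : ℤ) ^ k) • y)) :
    c = c' := by
  letI : Algebra ℚ_[2] (v.adicCompletion K) := LocalField.adicCompletionPadicAlgebra v 2 hv
  have h1 : Module.finrank ℚ_[2] (v.adicCompletion K) = 1 := by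
    rw [Literature.NumberTheory.NumberFields.finrank_adicCompletionPadicAlgebra_eq 2 v hv]
    exact ramificationIdx_mul_inertiaDeg_eq_one_of_ne hK2 hv hvbar hne
  haveI : FiniteDimensional ℚ_[2] (v.adicCompletion K) := Module.finite_of_finrank_pos (by rw [h1]; exact one_pos)
  obtain ⟨U, hU, ⟨eU⟩⟩ := exists_finiteIndex_addEquiv_padicInt_of_finrank_eq_one 2 h1 V
  haveI := hU
  exact scalar_unique U eU f (by exact_mod_cast hc) (by exact_mod_cast hc')

/-- **RANK-ONE RELATION at a dyadic place of the frame**: for a point `x₀ ∈ V(K_v)` of infinite order and any `y ∈ V(K_v)`,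
`2^a·y ≡ M·x₀ (mod 2^K V(K_v) + torsion)` for some `a` and, for every `K`, some integer `M` (`V(K_v)/tors ↪ ℚ₂` is a line).
This is the «`E(K_{𝔭*}) ⊗ D_{𝔭*}` is cocyclic» input of Agboola's Prop. 6.11 for `r = 1`.
[cite: SilvermanAEC2009, Prop. VII.6.3] [cite: Agboola2007, Prop. 6.11 (arXiv p0014)] -/
theorem exists_rankOne_rel_adicCompletion_two {K : Type} [Field K] [NumberField K] (hK2 : Module.finrank ℚ K = 2)
    {v vbar : HeightOneSpectrum (𝓞 K)} (hv : ((2 : ℕ) : 𝓞 K) ∈ v.asIdeal) (hvbar : ((2 : ℕ) : 𝓞 K) ∈ vbar.asIdeal)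
    (hne : vbar ≠ v) (V : WeierstrassCurve (v.adicCompletion K)) [V.IsElliptic]
    {x₀ : V.toAffine.Point} (hx₀ : ¬ IsOfFinAddOrder x₀) (y : V.toAffine.Point) :
    ∃ a : ℕ, ∀ K' : ℕ, ∃ (M : ℤ) (y' : V.toAffine.Point),
      IsOfFinAddOrder (((2 : ℤ) ^ a) • y - M • x₀ - ((2 : ℤ) ^ K') • y') := by
  letI : Algebra ℚ_[2] (v.adicCompletion K) := LocalField.adicCompletionPadicAlgebra v 2 hv
  have h1 : Module.finrank ℚ_[2] (v.adicCompletion K) = 1 := by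
    rw [Literature.NumberTheory.NumberFields.finrank_adicCompletionPadicAlgebra_eq 2 v hv]
    exact ramificationIdx_mul_inertiaDeg_eq_one_of_ne hK2 hv hvbar hne
  haveI : FiniteDimensional ℚ_[2] (v.adicCompletion K) := Module.finite_of_finrank_pos (by rw [h1]; exact one_pos)
  obtain ⟨U, hU, ⟨eU⟩⟩ := exists_finiteIndex_addEquiv_padicInt_of_finrank_eq_one 2 h1 V
  haveI := hU
  have h := exists_rankOne_rel U eU hx₀ y
  exact_mod_cast h

/-- **NO DIVISIBLE POINTS modulo torsion at a dyadic place of the frame**: a point of `V(K_v)` lying in `2^K V(K_v) + torsion` for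
every `K` is torsion. [cite: SilvermanAEC2009, Prop. VII.6.3] -/
theorem isOfFinAddOrder_of_forall_exists_adicCompletion_two {K : Type} [Field K] [NumberField K] (hK2 : Module.finrank ℚ K = 2)
    {v vbar : HeightOneSpectrum (𝓞 K)} (hv : ((2 : ℕ) : 𝓞 K) ∈ v.asIdeal) (hvbar : ((2 : ℕ) : 𝓞 K) ∈ vbar.asIdeal)
    (hne : vbar ≠ v) (V : WeierstrassCurve (v.adicCompletion K)) [V.IsElliptic]
    {x : V.toAffine.Point} (hx : ∀ K' : ℕ, ∃ y : V.toAffine.Point, IsOfFinAddOrder (x - ((2 : ℤ) ^ K') • y)) :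
    IsOfFinAddOrder x := by
  letI : Algebra ℚ_[2] (v.adicCompletion K) := LocalField.adicCompletionPadicAlgebra v 2 hv
  have h1 : Module.finrank ℚ_[2] (v.adicCompletion K) = 1 := by
    rw [Literature.NumberTheory.NumberFields.finrank_adicCompletionPadicAlgebra_eq 2 v hv]
    exact ramificationIdx_mul_inertiaDeg_eq_one_of_ne hK2 hv hvbar hne
  haveI : FiniteDimensional ℚ_[2] (v.adicCompletion K) := Module.finite_of_finrank_pos (by rw [h1]; exact one_pos)
  obtain ⟨U, hU, ⟨eU⟩⟩ := exists_finiteIndex_addEquiv_padicInt_of_finrank_eq_one 2 h1 V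
  haveI := hU
  exact isOfFinAddOrder_of_forall_exists U eU (by exact_mod_cast hx)

end Frame

end Summit.BirchSwinnertonDyer.BirchSwinnertonDyer.Theorems.PrintCf2.LocalPointsScalar

end
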